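import Summits.BirchSwinnertonDyer.BirchSwinnertonDyer.Theorems.InertBadSignedBranchesInertBadAtThreeQuarticModelUnit
import Summits.BirchSwinnertonDyer.BirchSwinnertonDyer.Theorems.PrintCFramJZeroThreeTraceFormBadPrimes
import Literature.NumberTheory.EllipticCurves.ComplexMultiplicationShaRubinRationalCMProofs
import HarnessLib

set_option linter.dupNamespace false -- `Summit.BirchSwinnertonDyer.BirchSwinnertonDyer.Theorems.…` (summit = sub, D-0017)
set_option autoImplicit false

/-!
# Crux `ManinDatumSupercuspidalCMInert` (stmt-BirchSwinnertonDyer-20111, BED r605), stub `stub_S5` — the MODEL LANE, prime-generic: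
# the sextic cell `j = 0` at a prime `p ≥ 5` is the integral family `y² = x³ + k`, `p ∣ k`, `k` sixth-power-free, with a `p`-ADIC UNIT
# scaling (width seat `bsd-wall-cm-bed-w2` g10; theorems only; `--supports 20111`, helper)

Route `BiquadraticEisensteinDescent` (cell `pub/bsd-wall`, D-0152 M1). The registered stub `stub_S5` of crux R₅₇-supercuspidal (skeleton
`9438078f…`) concerns CM curves `W/ℚ` with `j(W) = 0` additive at `p = 5` (Kodaira II / IV / IV* / II*); it is CLOSED MODULO the named
fact F″ (`…OfKato`, p596084) and reduced by width seat bsd-wall-cm-bed-w4 g10's pointwise tame-twist lever to the plain `5`-integrality,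
in Néron units, of the odd twisted modular-symbol sums of the newform of `W`. Sextic twin of `…CMInertCMModelsQuartic`: the value
statements move from `W` to the Mordell model `y² = x³ + k` with its own `a_n` and Néron-type periods
(`…InertBadAtThreeQuarticModel.LValueOdd_of_smul` / `LValueEven_of_smul` are stated for ANY model `C • V` and any prime `p ∤ den u_C`).

* `exists_eq_pow_six_mul_sixthPowerFree` — sixth-power-free parts of integers; `Δ_sextic` — `Δ(y² = x³ + k) = −432k²`;
* `padicValRat_u_eq_zero_of_smul_eq_sextic` — `C • V = ⟨0,0,0,0,k⟩`, `k ∈ ℤ`, `p⁶ ∤ k`, `V` globally minimal, `p ≥ 5` ⇒ `v_p(u_C) = 0`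
  (`12·v_p(u_C) + 2·v_p(k) = v_p(Δ(V)) ≤ 2·v_p(k) ≤ 10`, and `v_p(Δ(V)) ≥ 0`);
* `hasGoodReductionAt_of_eq_sextic_unit` — `y² = x³ + k` with `ord_v k = 0` (`v ∤ 6`) is good at `v`;
* `exists_smul_eq_sextic_of_five_le`, ★ `exists_smul_eq_sextic_sixthPowerFree` — every globally minimal `V` with `j(V) = 0` bad at
  `p ≥ 5` has `C • V = ⟨0,0,0,0,k⟩` with `k ≠ 0`, `p ∣ k`, `q⁶ ∤ k` for every prime `q`, and `v_p(u_C) = 0`;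
* `one_le_padicValInt_sextic` — then `1 ≤ v_p(k) ≤ 5`; `dvd_conductorNorm_of_prime_dvd_sextic` /
  `not_dvd_sextic_of_not_dvd_conductorNorm` — a prime `ℓ ≥ 5` with `ℓ ∣ k`, `ℓ⁶ ∤ k` divides `N_V` (cell `bsd-print-cfram`'s
  `PrintCFram.not_hasGoodReductionAtPrime_of_dvd_mordell`), so `ℓ ∤ N_V`, `ℓ ≥ 5` gives `ℓ ∤ k`.

HONEST FRAMING: bookkeeping only (Silverman *AEC* X.5.4 (iii), VII.1 Remark 1.1, VII.5 Prop. 5.1 (a); *ATAEC* IV.9.4); nothing here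
proves an `L`-value integrality, the stub, the crux, Manin's conjecture or BSD. No definition, no named fact, no `sorry`.
-/

noncomputable section

open scoped Classical NumberField

open WeierstrassCurve NumberField IsDedekindDomain Rat.HeightOneSpectrum
open Literature.NumberTheory.EllipticCurves
open Literature.NumberTheory.GaloisRepresentations
open Literature.NumberTheory.DiophantineGeometry
open Literature.NumberTheory.EllipticCurves.Rank1Residual
open Summit.BirchSwinnertonDyer.Rank1Residual
open Summit.BirchSwinnertonDyer.Rank1Residual.X12

namespace Summit.BirchSwinnertonDyer.BirchSwinnertonDyer.Theorems.BiquadraticEisensteinDescentManinDatumSupercuspidalCMInertCMModelsSextic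


/-! ## §0 Small arithmetic -/

/-- A prime `p ≥ 5` does not divide `432 = 2⁴·3³`. [folklore] -/
theorem not_dvd_fourThirtyTwo {p : ℕ} (hp : p.Prime) (hp5 : 5 ≤ p) : ¬ p ∣ 432 := by
  intro h
  have h' : p ∣ 2 ^ 4 * 3 ^ 3 := by simpa using h
  rcases (Nat.Prime.dvd_mul hp).mp h' with h2 | h3
  · have := (Nat.prime_dvd_prime_iff_eq hp Nat.prime_two).mp (hp.dvd_of_dvd_pow h2); omega
  · have := (Nat.prime_dvd_prime_iff_eq hp Nat.prime_three).mp (hp.dvd_of_dvd_pow h3); omega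

/-- `v_p(432) = 0` for a prime `p ≥ 5`. [folklore] -/
theorem padicValNat_fourThirtyTwo_eq_zero {p : ℕ} (hp : p.Prime) (hp5 : 5 ≤ p) : padicValNat p 432 = 0 :=
  padicValNat.eq_zero_of_not_dvd (not_dvd_fourThirtyTwo hp hp5)

/-! ## §1 The sextic cell `j = 0` at a prime `p ≥ 5` -/

section Sextic

/-- Every nonzero integer is `k = m⁶ · B` with `m ≥ 1` and `B` SIXTH-POWER-FREE (no prime `q` with `q⁶ ∣ B`); strong induction on
`|k|`, peeling off one prime sixth power at a time. [folklore] -/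
theorem exists_eq_pow_six_mul_sixthPowerFree (A : ℤ) (hA : A ≠ 0) :
    ∃ (m : ℕ) (B : ℤ), 0 < m ∧ A = (m : ℤ) ^ 6 * B ∧ ∀ q : ℕ, q.Prime → ¬ ((q : ℤ) ^ 6 ∣ B) := by
  induction h : A.natAbs using Nat.strong_induction_on generalizing A with
  | _ n ih =>
    by_cases hex : ∃ q : ℕ, q.Prime ∧ (q : ℤ) ^ 6 ∣ A
    · obtain ⟨q, hq, ⟨A', hA'⟩⟩ := hex
      have hA'0 : A' ≠ 0 := by rintro rfl; rw [mul_zero] at hA'; exact hA hA'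
      have hlt : A'.natAbs < n := by
        rw [← h, hA', Int.natAbs_mul, Int.natAbs_pow, Int.natAbs_natCast]
        have h2 : 2 ≤ q := hq.two_le
        have hpos : 0 < A'.natAbs := Int.natAbs_pos.mpr hA'0
        have h64 : 64 ≤ q ^ 6 := by
          calc 64 = 2 ^ 6 := by norm_num
            _ ≤ q ^ 6 := Nat.pow_le_pow_left h2 6
        nlinarith
      obtain ⟨m', B, hm', hAB, hB⟩ := ih _ hlt A' hA'0 rfl
      refine ⟨q * m', B, Nat.mul_pos hq.pos hm', ?_, hB⟩
      rw [hA', hAB]; push_cast; ring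
    · simp only [not_exists, not_and] at hex
      exact ⟨1, A, Nat.one_pos, by simp, hex⟩

/-- `Δ(y² = x³ + B) = −432·B²` (over `ℚ`). [cite: SilvermanAEC2009, III.1] -/
theorem Δ_sextic (B : ℚ) : (⟨0, 0, 0, 0, B⟩ : WeierstrassCurve ℚ).Δ = -432 * B ^ 2 := by
  simp only [WeierstrassCurve.Δ, WeierstrassCurve.b₂, WeierstrassCurve.b₄, WeierstrassCurve.b₆, WeierstrassCurve.b₈]
  ring

variable {p : ℕ} [hp : Fact p.Prime]

/-- ★ **The scaling to a `p`-sixth-power-free sextic model is a `p`-adic unit** (`p ≥ 5`). For a globally minimal elliptic `V/ℚ` and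
`C` with `C • V = ⟨0, 0, 0, 0, k⟩`, `k ∈ ℤ`, `p⁶ ∤ k`: `v_p(u_C) = 0` (the model is `p`-integral, so minimality of `V` at `p` bounds
`12·v_p(u_C) + 2·v_p(k) = v_p(Δ(V)) ≤ v_p(−432k²) = 2·v_p(k) ≤ 10`, and `v_p(Δ(V)) ≥ 0`). [cite: SilvermanAEC2009, VII.1 Remark 1.1 and Prop. 1.3] -/
theorem padicValRat_u_eq_zero_of_smul_eq_sextic (hp5 : 5 ≤ p) (V : WeierstrassCurve ℚ) [V.IsElliptic] [V.IsGloballyMinimal]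
    {k : ℤ} {C : VariableChange ℚ} (hCV : C • V = ⟨0, 0, 0, 0, (k : ℚ)⟩) (h6 : ¬ (p : ℤ) ^ 6 ∣ k) :
    padicValRat p (C.u : ℚ) = 0 := by
  have hpP : p.Prime := hp.out
  have hk0 : k ≠ 0 := by
    intro hk
    have hΔ : (C • V).Δ ≠ 0 := (C • V).isUnit_Δ.ne_zero
    rw [hCV, Δ_sextic, hk] at hΔ
    norm_num at hΔ
  -- the place `v = (p)` of `ℤ`
  set v : HeightOneSpectrum ℤ := (Rat.HeightOneSpectrum.primesEquiv (R := ℤ)).symm ⟨p, hpP⟩ with hvdef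
  have hv : Rat.HeightOneSpectrum.natGenerator v = p :=
    congrArg Subtype.val ((Rat.HeightOneSpectrum.primesEquiv (R := ℤ)).apply_symm_apply ⟨p, hpP⟩)
  -- the model is integral at `p`, so `v_p(Δ(V)) ≤ v_p(Δ(model))`
  have hint : (C • V).IsIntegralAt v := by
    rw [hCV, show (⟨0, 0, 0, 0, (k : ℚ)⟩ : WeierstrassCurve ℚ) = (⟨0, 0, 0, 0, k⟩ : WeierstrassCurve ℤ).baseChange ℚ by
      ext <;> simp [WeierstrassCurve.baseChange, WeierstrassCurve.map]]
    exact isIntegralAt_baseChange_int v _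
  have hle := valuation_Δ_smul_le_of_isMinimalAt v (IsGloballyMinimal.isMinimalAt_int V v) C hint
  rw [hCV, Δ_sextic] at hle
  have hu0 : (C.u : ℚ) ≠ 0 := C.u.ne_zero
  have hk0' : (k : ℚ) ≠ 0 := by exact_mod_cast hk0
  have hΔV : V.Δ = (C.u : ℚ) ^ 12 * (-432 * (k : ℚ) ^ 2) := by
    have h := congrArg WeierstrassCurve.Δ hCV
    rw [variableChange_Δ, Δ_sextic, Units.val_inv_eq_inv_val] at h
    field_simp at h
    linear_combination h
  have hΔV0 : V.Δ ≠ 0 := by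
    rw [hΔV]; exact mul_ne_zero (pow_ne_zero _ hu0) (mul_ne_zero (by norm_num) (pow_ne_zero _ hk0'))
  have hΔk0 : (-432 * (k : ℚ) ^ 2) ≠ 0 := mul_ne_zero (by norm_num) (pow_ne_zero _ hk0')
  rw [Rat.HeightOneSpectrum.valuation_eq_exp_neg_padicValRat v hΔk0,
    Rat.HeightOneSpectrum.valuation_eq_exp_neg_padicValRat v hΔV0, hv, WithZero.exp_le_exp, neg_le_neg_iff] at hle
  -- valuations
  have h432 : padicValRat p (-432 : ℚ) = 0 := by
    rw [padicValRat.neg, show (432 : ℚ) = ((432 : ℕ) : ℚ) by norm_num, padicValRat.of_nat,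
      padicValNat_fourThirtyTwo_eq_zero hpP hp5]
    simp
  have hvmod : padicValRat p (-432 * (k : ℚ) ^ 2) = 2 * padicValInt p k := by
    rw [padicValRat.mul (by norm_num) (pow_ne_zero _ hk0'), h432, padicValRat.pow (k : ℚ), padicValRat.of_int]; ring
  have hvV : padicValRat p V.Δ = 12 * padicValRat p (C.u : ℚ) + 2 * padicValInt p k := by
    rw [hΔV, padicValRat.mul (pow_ne_zero _ hu0) hΔk0, padicValRat.pow (C.u : ℚ), hvmod]; ring
  have hmin : (0 : ℤ) ≤ padicValRat p V.Δ := by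
    rw [← cast_minimalDiscriminantInt V, padicValRat.of_int]; exact_mod_cast Nat.zero_le _
  have hk5 : padicValInt p k ≤ 5 := by
    by_contra h
    exact h6 (by exact_mod_cast (padicValInt_dvd_iff (p := p) 6 k).mpr (Or.inr (by omega)))
  rw [hvmod, hvV] at hle
  rw [hvV] at hmin
  have hk' : (padicValInt p k : ℤ) ≤ 5 := by exact_mod_cast hk5
  have h1 : padicValRat p (C.u : ℚ) ≤ 0 := by linarith
  have h2 : -1 < padicValRat p (C.u : ℚ) := by linarith
  omega

omit hp in
/-- **`y² = x³ + k` with `ord_v k = 0` (`v ∤ 6`) is GOOD at `v`** (integral equation with unit discriminant `−432k²`).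
[cite: SilvermanAEC2009, VII.1 Remark 1.1 and VII.5 Prop. 5.1 (a)] -/
theorem hasGoodReductionAt_of_eq_sextic_unit (W : WeierstrassCurve ℚ) [W.IsElliptic] (v : HeightOneSpectrum (𝓞 ℚ))
    (hv5 : 5 ≤ natGenerator v) {b : ℚ} (hW : W = ⟨0, 0, 0, 0, b⟩) (hb : v.valuation ℚ b = 1) :
    W.HasGoodReductionAt v := by
  have h432' : ¬ (natGenerator v : ℤ) ∣ 432 := fun h ↦
    not_dvd_fourThirtyTwo (prime_natGenerator v) hv5 (by exact_mod_cast h)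
  have h432 : v.valuation ℚ (432 : ℚ) = 1 := by
    have := Rat.valuation_intCast_eq_one v h432'; exact_mod_cast this
  have e₆ : W.a₆ = b := by rw [hW]
  have eΔ : W.Δ = -(432 : ℚ) * b ^ 2 := by rw [hW, Δ_sextic]
  have hint : W.IsIntegralAt v :=
    W.isIntegralAt_of_valuation_le_one v (by rw [hW, map_zero]; exact zero_le_one)
      (by rw [hW, map_zero]; exact zero_le_one) (by rw [hW, map_zero]; exact zero_le_one)
      (by rw [hW, map_zero]; exact zero_le_one) (by rw [e₆, hb])
  have hΔ : v.valuation ℚ W.Δ = 1 := by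
    rw [eΔ, map_mul, Valuation.map_neg, h432, one_mul, map_pow, hb, one_pow]
  have hmin : W.IsMinimalAt v :=
    isMinimalAt_of_lt_valuation_Δ_holds hint
      (by rw [hΔ, ← WithZero.exp_zero]; exact WithZero.exp_lt_exp.mpr (by norm_num))
  exact (hasGoodReductionAt_iff_of_isMinimalAt hmin).mpr hΔ

/-- **The sextic cell is the family `y² = x³ + k`, `p ∣ k`, `k` sixth-power-free** (`p ≥ 5`). A globally minimal `V/ℚ` with `j(V) = 0`
bad at `p` is `ℚ`-isomorphic to `⟨0,0,0,0,k⟩` for a sixth-power-free `k ∈ ℤ ∖ 0` with `p ∣ k`: *AEC* X.5.4 (iii) normal form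
`exists_smul_eq_of_j_eq_zero` (`y² = x³ + B`, `B ∈ ℚˣ`), the scaling `(1/den B; 0,0,0)` to an integer (`B ↦ den(B)⁶·B`), the scalings
`(m; 0,0,0)` to the sixth-power-free part (`X12.smul_cubic_scale`), and good reduction of `y² = x³ + k` at `p ∤ 6k` transported along
`ℚ`-isomorphisms. [cite: SilvermanAEC2009, X.5.4 (iii) and VII.5 Prop. 5.1 (a)] -/
theorem exists_smul_eq_sextic_of_five_le (hp5 : 5 ≤ p) (V : WeierstrassCurve ℚ) [V.IsElliptic] [V.IsGloballyMinimal]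
    (hj : V.j = 0) (hbad : ¬ V.HasGoodReductionAtPrime p) :
    ∃ (k : ℤ) (C : WeierstrassCurve.VariableChange ℚ), C • V = ⟨0, 0, 0, 0, (k : ℚ)⟩ ∧ k ≠ 0 ∧ (p : ℤ) ∣ k ∧
      (∀ q : ℕ, q.Prime → ¬ ((q : ℤ) ^ 6 ∣ k)) := by
  have hpP : p.Prime := hp.out
  -- the normal form `C₀ • V = (y² = x³ + B)`, `B ∈ ℚ ∖ {0}`
  obtain ⟨B, C₀, hB0, hC₀⟩ := Rubin1987.exists_smul_eq_of_j_eq_zero (V := V) hj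
  -- clear the denominator: `u = 1/den B`, `B ↦ den(B)⁶ · B = den(B)⁵ · num B`
  have hd0 : (B.den : ℚ) ≠ 0 := by exact_mod_cast B.den_pos.ne'
  set u₁ : ℚˣ := Units.mk0 ((B.den : ℚ))⁻¹ (inv_ne_zero hd0) with hu₁
  set A : ℤ := (B.den : ℤ) ^ 5 * B.num with hA
  have hAq : (A : ℚ) = (B.den : ℚ) ^ 6 * B := by
    have h1 : (B.den : ℚ) * B = B.num := Rat.den_mul_eq_num B
    rw [hA, show (B.den : ℚ) ^ 6 * B = (B.den : ℚ) ^ 5 * ((B.den : ℚ) * B) by ring, h1]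
    push_cast; ring
  have hA0 : A ≠ 0 := by
    rw [hA]; exact mul_ne_zero (pow_ne_zero _ (by exact_mod_cast B.den_pos.ne')) (Rat.num_ne_zero.mpr hB0)
  set C₁ : VariableChange ℚ := ⟨u₁, 0, 0, 0⟩ * C₀ with hC₁
  have hC₁V : C₁ • V = ⟨0, 0, 0, 0, (A : ℚ)⟩ := by
    rw [hC₁, mul_smul, hC₀, X12.smul_cubic_scale, hAq, hu₁]
    congr 1
    rw [Units.val_inv_eq_inv_val, Units.val_mk0, inv_inv]
  -- the sixth-power-free part `A = m⁶ k`, rescale by `u = m`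
  obtain ⟨m, k, hm, hAk, hk⟩ := exists_eq_pow_six_mul_sixthPowerFree A hA0
  have hk0 : k ≠ 0 := by rintro rfl; rw [mul_zero] at hAk; exact hA0 hAk
  have hm0 : (m : ℚ) ≠ 0 := by exact_mod_cast hm.ne'
  set u : ℚˣ := Units.mk0 (m : ℚ) hm0 with hu
  have hu6 : ((u : ℚ))⁻¹ ^ 6 * ((m : ℚ)) ^ 6 = 1 := by
    rw [← mul_pow, hu, Units.val_mk0, inv_mul_cancel₀ hm0, one_pow]
  set e : VariableChange ℚ := ⟨u, 0, 0, 0⟩ * C₁ with he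
  have hD : e • V = ⟨0, 0, 0, 0, (k : ℚ)⟩ := by
    rw [he, mul_smul, hC₁V, X12.smul_cubic_scale, hAk]
    push_cast
    rw [← mul_assoc, hu6, one_mul]
  haveI : (e • V).IsElliptic := inferInstance
  -- `p ∣ k`: otherwise good reduction at `p`
  have hpk : (p : ℤ) ∣ k := by
    by_contra hpk
    set v : HeightOneSpectrum (𝓞 ℚ) := (primesEquiv (R := 𝓞 ℚ)).symm ⟨p, hpP⟩ with hvdef
    have hpv : primesEquiv v = ⟨p, hpP⟩ := (primesEquiv (R := 𝓞 ℚ)).apply_symm_apply ⟨p, hpP⟩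
    have hv : natGenerator v = p := congrArg Subtype.val hpv
    have hv5 : 5 ≤ natGenerator v := by rw [hv]; exact hp5
    have hval : v.valuation ℚ ((k : ℤ) : ℚ) = 1 :=
      Rat.valuation_intCast_eq_one v (by rw [hv]; exact_mod_cast hpk)
    have hgood := hasGoodReductionAt_of_eq_sextic_unit (e • V) v hv5 hD hval
    exact hbad ((good_iff_hasGoodReductionAt V p v hv).mpr ((hasGoodReductionAt_smul_iff_holds v V e).mp hgood))
  exact ⟨k, e, hD, hk0, hpk, hk⟩

/-- ★ **The sixth-power-free sextic model with `p`-adic unit scaling** (`p ≥ 5`). Every globally minimal elliptic `V/ℚ` with `j(V) = 0`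
bad at `p` has `C • V = ⟨0, 0, 0, 0, k⟩` with `k ∈ ℤ ∖ 0`, `p ∣ k`, `q⁶ ∤ k` for every prime `q`, and `v_p(u_C) = 0` — so
`…QuarticModel.LValueOdd_of_smul` / `LValueEven_of_smul` (stated for any model `C • V`) move the `f`-free value statements between `V`
and its Mordell model at `p`. [cite: SilvermanAEC2009, X.5.4 (iii) and VII.1 Remark 1.1] -/
theorem exists_smul_eq_sextic_sixthPowerFree (hp5 : 5 ≤ p) (V : WeierstrassCurve ℚ) [V.IsElliptic] [V.IsGloballyMinimal]
    (hj : V.j = 0) (hbad : ¬ V.HasGoodReductionAtPrime p) :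
    ∃ (k : ℤ) (C : VariableChange ℚ), C • V = ⟨0, 0, 0, 0, (k : ℚ)⟩ ∧ k ≠ 0 ∧ (p : ℤ) ∣ k ∧
      (∀ q : ℕ, q.Prime → ¬ ((q : ℤ) ^ 6 ∣ k)) ∧ padicValRat p (C.u : ℚ) = 0 := by
  obtain ⟨k, C, hCV, hk0, hpk, h6⟩ := exists_smul_eq_sextic_of_five_le hp5 V hj hbad
  exact ⟨k, C, hCV, hk0, hpk, h6, padicValRat_u_eq_zero_of_smul_eq_sextic hp5 V hCV (h6 p hp.out)⟩

omit hp in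
/-- **The five cells**: for `k ≠ 0` with `p ∣ k` and `p⁶ ∤ k`, `1 ≤ v_p(k) ≤ 5` (Kodaira II / IV / I₀* / IV* / II* for `y² = x³ + k`,
`p ≥ 5`). [cite: SilvermanATAEC1994, IV.9.4 and Table 4.1] -/
theorem one_le_padicValInt_sextic [Fact p.Prime] {k : ℤ} (hk0 : k ≠ 0) (hpk : (p : ℤ) ∣ k) (h6 : ¬ (p : ℤ) ^ 6 ∣ k) :
    1 ≤ padicValInt p k ∧ padicValInt p k ≤ 5 := by
  constructor
  · rcases (padicValInt_dvd_iff (p := p) 1 k).mp (by simpa using hpk) with h | h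
    · exact absurd h hk0
    · exact h
  · by_contra h
    exact h6 ((padicValInt_dvd_iff (p := p) 6 k).mpr (Or.inr (by omega)))

omit hp in
/-- ★ **A prime `ℓ ≥ 5` with `ℓ ∣ k`, `ℓ⁶ ∤ k` divides the conductor** of any elliptic `V` with a model `C • V = (y² = x³ + k)`: the
model is bad at `ℓ` (Tate, cell `bsd-print-cfram`'s `PrintCFram.not_hasGoodReductionAtPrime_of_dvd_mordell`), good reduction is an
isomorphism invariant, and `ℓ ∣ N_V ⟺` bad at `ℓ` (`dvd_conductorNorm_iff_not_hasGoodReductionAtPrime`).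
[cite: SilvermanATAEC1994, IV.9.4 and Table 4.1] [cite: SilvermanAEC2009, VII.5 Prop. 5.1 (a)] -/
theorem dvd_conductorNorm_of_prime_dvd_sextic (V : WeierstrassCurve ℚ) [V.IsElliptic]
    {k : ℤ} {C : VariableChange ℚ} (hCV : C • V = ⟨0, 0, 0, 0, (k : ℚ)⟩)
    {ℓ : ℕ} (hℓ : ℓ.Prime) (hℓ5 : 5 ≤ ℓ) (hℓk : (ℓ : ℤ) ∣ k) (hℓ6 : ¬ (ℓ : ℤ) ^ 6 ∣ k) :
    ℓ ∣ V.conductorNorm ℤ := by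
  haveI : Fact ℓ.Prime := ⟨hℓ⟩
  have hbad : ¬ V.HasGoodReductionAtPrime ℓ :=
    PrintCFram.not_hasGoodReductionAtPrime_of_dvd_mordell V ⟨C, by rw [hCV]; rfl⟩ ℓ hℓ5 hℓk hℓ6
  exact (V.dvd_conductorNorm_iff_not_hasGoodReductionAtPrime ℓ).mpr hbad

omit hp in
/-- ★ **For the sixth-power-free model, a prime `ℓ ∤ N_V` with `ℓ ≥ 5` does not divide `k`** (the coprimality a theta dictionary over
`ℤ[ω]` needs from a stub's hypothesis `ℓ ∤ N_V`). [cite: SilvermanAEC2009, VII.5 Prop. 5.1 (a)] -/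
theorem not_dvd_sextic_of_not_dvd_conductorNorm (V : WeierstrassCurve ℚ) [V.IsElliptic]
    {k : ℤ} {C : VariableChange ℚ} (hCV : C • V = ⟨0, 0, 0, 0, (k : ℚ)⟩)
    (h6 : ∀ q : ℕ, q.Prime → ¬ ((q : ℤ) ^ 6 ∣ k))
    {ℓ : ℕ} (hℓ : ℓ.Prime) (hℓ5 : 5 ≤ ℓ) (hℓN : ¬ ℓ ∣ V.conductorNorm ℤ) : ¬ (ℓ : ℤ) ∣ k :=
  fun h ↦ hℓN (dvd_conductorNorm_of_prime_dvd_sextic V hCV hℓ hℓ5 h (h6 ℓ hℓ))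

end Sextic

end Summit.BirchSwinnertonDyer.BirchSwinnertonDyer.Theorems.BiquadraticEisensteinDescentManinDatumSupercuspidalCMInertCMModelsSextic

end
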